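import Summits.QuantumFields.YangMills.Theorems.BalabanLadderNTSubsequentialUnitSums
import Summits.QuantumFields.YangMills.Theorems.SqueezedSkewnessCeilingFromMoments
import HarnessLib

/-!
# Crux `NT` (stmt-QuantumFields-19353): the collar bound makes NT's two smeared functionals LIPSCHITZ IN THE UNIT —
# the equicontinuity modulus of the dilation family at one coupling on one torus

Helper file (`--supports stmt-QuantumFields-19353`) of the fleet lead prover of crux `NT` (unit `ym-spine-19353-p1`, g29),
hypothesis-free; sequel of `…NTSubsequentialCompactFamily` (§1 there: compact witness families reduce to one witness given a
Lipschitz modulus) and `…NTSubsequentialUnitSums` (geometry and `ℓ¹` sums of dilates).  Here the modulus is SUPPLIED for the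
dilation family `v_μ = v ∘ (μ •)` of compactly supported witnesses, at ONE coupling on ONE odd torus, from the `n`-point collar
bound of `MomentBounds` (constant `C`, radius `R`) — the same input as g23's `MirrorDescentModulus.modulus_bound` (shift family):

* support / gap bookkeeping of dilates (`tsupport_dilate_subset`, `gap_of_dilate_ne_zero'`, `neg_gap_of_theta_dilate_ne_zero'`),
  **`dist_ge_of_charged_dilates`** (charged points of two dilates with nearby parameters stay `δ/(2m₂)` apart);
* **`abs_Q2_dilate_sub_le`** — `|Q2(s)(θv_μ, v_μ) − Q2(s)(θv_ν, v_ν)| ≤ (C/R⁴)² · 2 · Dsum · Sm` with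
  `Dsum = Lip (σ/m₁)|μ−ν|(2σ/m₁+3)⁴/s⁴`, `Sm = M(2σ+3)⁴/(m₁s)⁴` (time gap `δ₀/m₂`, no wrap-around `2σ/m₁ ≤ sL`, collar room
  `(R+2)s ≤ δ₀/m₂`);
* **`abs_Q3_dilate_sub_le`** — `|Q3(s)(f_μ,g_μ,h_μ) − Q3(s)(f_ν,g_ν,h_ν)| ≤ (C/R⁴)³ · 3 · Dsum · Sm²` for pairwise `δ`-separated
  witnesses, `|μ−ν|(σ/m₁) ≤ δ/2`, collar room `4(R+2)s ≤ δ/(2m₂)`.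
With `R ≍ 1/s` both right sides are `s`-free: the equicontinuity modulus consumed by `subseq_of_lipschitzFamily` (file
`…NTSubsequentialUnitRobustness`).

HONEST FRAMING: finite-torus bookkeeping at one coupling; the collar bound is a HYPOTHESIS (it is the UV leg `MomentBounds`);
nothing about `NT`, floors, the gap, or Clay. [folklore]
-/

set_option autoImplicit false

noncomputable section

open scoped SchwartzMap
open MeasureTheory Filter Topology Finset
open Literature.MathematicalPhysics.QuantumFieldTheory Literature.MathematicalPhysics.QuantumLattice
open Literature.Probability.LatticeModels
open Summit.QuantumFields.YangMills.Cruxes.OSLegsFromFemtoAndGap.DlrCollarTransfer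
open Summit.QuantumFields.YangMills.Cruxes.NT.Reference
  (sum_abs_lattice_le_sup_div tsupport_thetaTest_subset_closedBall_zero smul_siteToE_apply_zero)
open Summit.QuantumFields.YangMills.Theorems.MirrorDescentModulus (abs_Q2_sub_Q2_le abs_torusCov_le_two torusSep_of_gap)
open Summit.QuantumFields.YangMills.Theorems.CeilingFromMomentsProof (abs_torusK3_le_of_momentBound)
open Summit.QuantumFields.YangMills.Cruxes.UVSeamRec.UnitDilation (compCLM_apply_smul thetaTest_compCLM_apply tsupport_compCLM)

namespace Summit.QuantumFields.YangMills.Cruxes.NT.Subsequential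

/-! ## §4 The equicontinuity modulus of the dilation family under the collar bound -/

section Geometry2

variable {v f g : EuclideanSpace ℝ (Fin 4) → ℝ} {σ δ δ₀ m₁ m₂ : ℝ}

/-- A charged point of a dilate lies in the ball of radius `σ/m₁`. [folklore] -/
theorem norm_le_of_dilate_ne_zero' (hvσ : tsupport v ⊆ Metric.closedBall 0 σ) (hm₁ : 0 < m₁) {ρ : ℝ} (hρ : m₁ ≤ ρ)
    {y : EuclideanSpace ℝ (Fin 4)} (hne : v (ρ • y) ≠ 0) : ‖y‖ ≤ σ / m₁ := by
  have hmem := hvσ (subset_tsupport _ (Function.mem_support.2 hne))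
  rw [Metric.mem_closedBall, dist_zero_right, norm_smul, Real.norm_of_nonneg (hm₁.le.trans hρ)] at hmem
  rw [le_div_iff₀ hm₁]
  calc ‖y‖ * m₁ ≤ ‖y‖ * ρ := mul_le_mul_of_nonneg_left hρ (norm_nonneg _)
    _ = ρ * ‖y‖ := mul_comm _ _
    _ ≤ σ := hmem

/-- The support of a dilate `v ∘ D`, `D = ρ • id`, `ρ ≥ m₁ > 0`, lies in the ball of radius `σ/m₁`. [folklore] -/
theorem tsupport_dilate_subset {w : 𝓢(EuclideanSpace ℝ (Fin 4), ℝ)}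
    (hwσ : tsupport (w : EuclideanSpace ℝ (Fin 4) → ℝ) ⊆ Metric.closedBall 0 σ) (hm₁ : 0 < m₁) {ρ : ℝ} (hρ : m₁ ≤ ρ)
    (D : EuclideanSpace ℝ (Fin 4) ≃L[ℝ] EuclideanSpace ℝ (Fin 4)) (hD : ∀ x, D x = ρ • x) :
    tsupport (SchwartzMap.compCLMOfContinuousLinearEquiv ℝ D w : EuclideanSpace ℝ (Fin 4) → ℝ) ⊆
      Metric.closedBall 0 (σ / m₁) := by
  rw [tsupport_compCLM D w]
  intro y hy
  have hy' : ρ • y ∈ tsupport (w : EuclideanSpace ℝ (Fin 4) → ℝ) := by rw [← hD]; exact hy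
  have hmem := hwσ hy'
  rw [Metric.mem_closedBall, dist_zero_right, norm_smul, Real.norm_of_nonneg (hm₁.le.trans hρ)] at hmem
  rw [Metric.mem_closedBall, dist_zero_right, le_div_iff₀ hm₁]
  calc ‖y‖ * m₁ ≤ ‖y‖ * ρ := mul_le_mul_of_nonneg_left hρ (norm_nonneg _)
    _ = ρ * ‖y‖ := mul_comm _ _
    _ ≤ σ := hmem

/-- Time gap of a dilate: `v (ρ • p) ≠ 0`, all charged points of `v` at times `≥ δ₀ ≥ 0`, `0 < ρ ≤ m₂` ⇒ `δ₀/m₂ ≤ p 0`. [folklore] -/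
theorem gap_of_dilate_ne_zero' (hv : ∀ p : EuclideanSpace ℝ (Fin 4), v p ≠ 0 → δ₀ ≤ p 0) (hδ₀ : 0 ≤ δ₀)
    {ρ : ℝ} (hρ0 : 0 < ρ) (hρ : ρ ≤ m₂) {p : EuclideanSpace ℝ (Fin 4)} (hne : v (ρ • p) ≠ 0) : δ₀ / m₂ ≤ p 0 := by
  have h := hv _ hne
  rw [PiLp.smul_apply, smul_eq_mul] at h
  have hm₂ : 0 < m₂ := hρ0.trans_le hρ
  have ht : 0 ≤ p 0 := by
    by_contra hlt
    push Not at hlt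
    have : ρ * p 0 < 0 := mul_neg_of_pos_of_neg hρ0 hlt
    linarith
  rw [div_le_iff₀ hm₂]
  calc δ₀ ≤ ρ * p 0 := h
    _ ≤ m₂ * p 0 := mul_le_mul_of_nonneg_right hρ ht
    _ = p 0 * m₂ := mul_comm _ _

/-- Time gap of a reflected dilate: `v (ρ • θp) ≠ 0` ⇒ `p 0 ≤ −(δ₀/m₂)`. [folklore] -/
theorem neg_gap_of_theta_dilate_ne_zero' (hv : ∀ p : EuclideanSpace ℝ (Fin 4), v p ≠ 0 → δ₀ ≤ p 0) (hδ₀ : 0 ≤ δ₀)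
    {ρ : ℝ} (hρ0 : 0 < ρ) (hρ : ρ ≤ m₂) {p : EuclideanSpace ℝ (Fin 4)} (hne : v (ρ • timeReflection 4 p) ≠ 0) :
    p 0 ≤ -(δ₀ / m₂) := by
  have h := gap_of_dilate_ne_zero' hv hδ₀ hρ0 hρ hne
  have e : (timeReflection 4 p) 0 = -p 0 := by simp
  rw [e] at h
  linarith

/-- **Pairwise separation of charged points of two dilates with nearby parameters.**  If every charged point of `f` is at
distance `≥ δ` from every charged point of `g`, `g` is supported in `B̄(0, σ)`, `m₁ ≤ ρ ≤ m₂`, `m₁ ≤ ρ'` (`m₁ > 0`) and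
`|ρ − ρ'|·(σ/m₁) ≤ δ/2`, then `f (ρ • P) ≠ 0`, `g (ρ' • Q) ≠ 0` force `δ/(2m₂) ≤ ‖P − Q‖`. [folklore] -/
theorem dist_ge_of_charged_dilates (hfg : ∀ p q : EuclideanSpace ℝ (Fin 4), f p ≠ 0 → g q ≠ 0 → δ ≤ ‖p - q‖)
    (hgσ : tsupport g ⊆ Metric.closedBall 0 σ) (hm₁ : 0 < m₁) {ρ ρ' : ℝ} (hρ : m₁ ≤ ρ) (hρ₂ : ρ ≤ m₂)
    (hρ' : m₁ ≤ ρ') (hclose : |ρ - ρ'| * (σ / m₁) ≤ δ / 2)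
    {P Q : EuclideanSpace ℝ (Fin 4)} (hP : f (ρ • P) ≠ 0) (hQ : g (ρ' • Q) ≠ 0) : δ / (2 * m₂) ≤ ‖P - Q‖ := by
  have hm₂ : 0 < m₂ := hm₁.trans_le (hρ.trans hρ₂)
  have hQn : ‖Q‖ ≤ σ / m₁ := norm_le_of_dilate_ne_zero' hgσ hm₁ hρ' hQ
  have h1 := hfg _ _ hP hQ
  have hsplit : ρ • P - ρ' • Q = ρ • (P - Q) + (ρ - ρ') • Q := by
    rw [smul_sub, sub_smul]; abel
  have h2 : δ ≤ ρ * ‖P - Q‖ + |ρ - ρ'| * ‖Q‖ := by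
    calc δ ≤ ‖ρ • P - ρ' • Q‖ := h1
      _ = ‖ρ • (P - Q) + (ρ - ρ') • Q‖ := by rw [hsplit]
      _ ≤ ‖ρ • (P - Q)‖ + ‖(ρ - ρ') • Q‖ := norm_add_le _ _
      _ = ρ * ‖P - Q‖ + |ρ - ρ'| * ‖Q‖ := by
          rw [norm_smul, norm_smul, Real.norm_of_nonneg (hm₁.le.trans hρ), Real.norm_eq_abs]
  have h3 : |ρ - ρ'| * ‖Q‖ ≤ δ / 2 := (mul_le_mul_of_nonneg_left hQn (abs_nonneg _)).trans hclose
  have h4 : δ / 2 ≤ ρ * ‖P - Q‖ := by linarith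
  rw [div_le_iff₀ (by positivity : (0 : ℝ) < 2 * m₂)]
  calc δ = 2 * (δ / 2) := by ring
    _ ≤ 2 * (ρ * ‖P - Q‖) := by linarith
    _ ≤ 2 * (m₂ * ‖P - Q‖) := by gcongr
    _ = ‖P - Q‖ * (2 * m₂) := by ring

end Geometry2

section Modulus

variable (G : Type) [Group G] [TopologicalSpace G] [IsTopologicalGroup G] [CompactSpace G]
  [MeasurableSpace G] [BorelSpace G] (r : LatticeRep G)

/-- Monotonicity of the dilate-sum envelope in the parameter: `M (2σ+3)⁴/(ρ s)⁴ ≤ M (2σ+3)⁴/(m₁ s)⁴` for `ρ ≥ m₁ > 0`. [folklore] -/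
theorem env_div_pow_le {M σ m₁ ρ s : ℝ} (hM : 0 ≤ M) (hm₁ : 0 < m₁) (hρ : m₁ ≤ ρ) (hs : 0 < s) :
    M * (2 * σ + 3) ^ 4 / (ρ * s) ^ 4 ≤ M * (2 * σ + 3) ^ 4 / (m₁ * s) ^ 4 := by
  have h0 : 0 < (m₁ * s) ^ 4 := by positivity
  exact div_le_div_of_nonneg_left (by positivity) h0
    (pow_le_pow_left₀ (by positivity) (mul_le_mul_of_nonneg_right hρ hs.le) 4)

/-- **Modulus of the dilation family for the mirror two-point functional under the collar bound.**  At one coupling on one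
odd torus, under the `n`-point collar bound at radius `R` with constant `C`: for a witness `v` (sup `M`, Lipschitz `Lip`,
`tsupport v ⊆ B̄(0, σ)`, charged only at times `≥ δ₀ ≥ 0`), parameters `μ, ν ∈ [m₁, m₂]`, a spacing `0 < s ≤ 1` with
`μ s, ν s ≤ 1`, no wrap-around `2σ/m₁ ≤ sL` and collar room `(R+2)s ≤ δ₀/m₂`,
`|Q2(s)(θv_μ, v_μ) − Q2(s)(θv_ν, v_ν)| ≤ (C/R⁴)² · 2 · (Lip (σ/m₁)|μ−ν|(2σ/m₁+3)⁴/s⁴) · (M(2σ+3)⁴/(m₁s)⁴)`. [folklore] -/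
theorem abs_Q2_dilate_sub_le (β : ℝ) (L : ℕ) {C : ℝ} {R : ℕ}
    (H : ∀ (n : ℕ) (x : Fin n → (Fin 4 → ℤ)),
      (∀ i j : Fin n, i ≠ j → ∃ k : Fin 4,
        (2 * (R : ℤ) + 4) ≤ |((((x i k - x j k : ℤ) : ZMod (2 * L + 1))).valMinAbs : ℤ)|) →
      |torusE G r β L (fun U => ∏ i, (dens G r (x i) U - torusE G r β L (dens G r (x i))))| ≤ (C / (R : ℝ) ^ 4) ^ n)
    {v : 𝓢(EuclideanSpace ℝ (Fin 4), ℝ)} {M Lip σ δ₀ m₁ m₂ μ ν s : ℝ}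
    (hM : ∀ y : EuclideanSpace ℝ (Fin 4), |v y| ≤ M) (hLip0 : 0 ≤ Lip)
    (hLip : ∀ x y : EuclideanSpace ℝ (Fin 4), |v x - v y| ≤ Lip * ‖x - y‖) (hσ : 0 ≤ σ)
    (hvσ : tsupport (v : EuclideanSpace ℝ (Fin 4) → ℝ) ⊆ Metric.closedBall 0 σ)
    (hδ₀ : 0 ≤ δ₀) (hv0 : ∀ p : EuclideanSpace ℝ (Fin 4), v p ≠ 0 → δ₀ ≤ p 0)
    (hm₁ : 0 < m₁) (hμ₁ : m₁ ≤ μ) (hμ₂ : μ ≤ m₂) (hν₁ : m₁ ≤ ν) (hν₂ : ν ≤ m₂)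
    (hs : 0 < s) (hs1 : s ≤ 1) (hμs : μ * s ≤ 1) (hνs : ν * s ≤ 1)
    (hσL : 2 * (σ / m₁) ≤ s * L) (hRδ : ((R : ℝ) + 2) * s ≤ δ₀ / m₂)
    (D₁ D₂ : EuclideanSpace ℝ (Fin 4) ≃L[ℝ] EuclideanSpace ℝ (Fin 4)) (hD₁ : ∀ x, D₁ x = μ • x) (hD₂ : ∀ x, D₂ x = ν • x) :
    |Q2 G r β L s (thetaTest 4 (SchwartzMap.compCLMOfContinuousLinearEquiv ℝ D₁ v))
          (SchwartzMap.compCLMOfContinuousLinearEquiv ℝ D₁ v) -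
        Q2 G r β L s (thetaTest 4 (SchwartzMap.compCLMOfContinuousLinearEquiv ℝ D₂ v))
          (SchwartzMap.compCLMOfContinuousLinearEquiv ℝ D₂ v)| ≤
      (C / (R : ℝ) ^ 4) ^ 2 * (2 * ((Lip * (σ / m₁) * |μ - ν| * (2 * (σ / m₁) + 3) ^ 4 / s ^ 4) *
        (M * (2 * σ + 3) ^ 4 / (m₁ * s) ^ 4))) := by
  have hμ0 : 0 < μ := hm₁.trans_le hμ₁
  have hν0 : 0 < ν := hm₁.trans_le hν₁
  have hM0 : 0 ≤ M := (abs_nonneg _).trans (hM 0)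
  -- gaps and supports of the four test functions
  have hf : ∀ {ρ : ℝ} (D : EuclideanSpace ℝ (Fin 4) ≃L[ℝ] EuclideanSpace ℝ (Fin 4)), (∀ x, D x = ρ • x) → 0 < ρ → ρ ≤ m₂ →
      ∀ p : EuclideanSpace ℝ (Fin 4), thetaTest 4 (SchwartzMap.compCLMOfContinuousLinearEquiv ℝ D v) p ≠ 0 →
        p 0 ≤ -(δ₀ / m₂) := by
    intro ρ D hD hρ0 hρ p hp
    rw [thetaTest_apply, SchwartzMap.compCLMOfContinuousLinearEquiv_apply, Function.comp_apply, hD] at hp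
    exact neg_gap_of_theta_dilate_ne_zero' hv0 hδ₀ hρ0 hρ hp
  have hg : ∀ {ρ : ℝ} (D : EuclideanSpace ℝ (Fin 4) ≃L[ℝ] EuclideanSpace ℝ (Fin 4)), (∀ x, D x = ρ • x) → 0 < ρ → ρ ≤ m₂ →
      ∀ p : EuclideanSpace ℝ (Fin 4), SchwartzMap.compCLMOfContinuousLinearEquiv ℝ D v p ≠ 0 → δ₀ / m₂ ≤ p 0 := by
    intro ρ D hD hρ0 hρ p hp
    rw [SchwartzMap.compCLMOfContinuousLinearEquiv_apply, Function.comp_apply, hD] at hp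
    exact gap_of_dilate_ne_zero' hv0 hδ₀ hρ0 hρ hp
  have hb := Summit.QuantumFields.YangMills.Theorems.MirrorDescentModulus.modulus_bound G r β L H hs hσL hRδ
    (thetaTest 4 (SchwartzMap.compCLMOfContinuousLinearEquiv ℝ D₁ v))
    (thetaTest 4 (SchwartzMap.compCLMOfContinuousLinearEquiv ℝ D₂ v))
    (SchwartzMap.compCLMOfContinuousLinearEquiv ℝ D₁ v) (SchwartzMap.compCLMOfContinuousLinearEquiv ℝ D₂ v)
    (hf D₁ hD₁ hμ0 hμ₂) (hf D₂ hD₂ hν0 hν₂) (hg D₁ hD₁ hμ0 hμ₂) (hg D₂ hD₂ hν0 hν₂)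
    (tsupport_thetaTest_subset_closedBall_zero (tsupport_dilate_subset hvσ hm₁ hμ₁ D₁ hD₁))
    (tsupport_thetaTest_subset_closedBall_zero (tsupport_dilate_subset hvσ hm₁ hν₁ D₂ hD₂))
    (tsupport_dilate_subset hvσ hm₁ hμ₁ D₁ hD₁) (tsupport_dilate_subset hvσ hm₁ hν₁ D₂ hD₂)
  refine hb.trans (mul_le_mul_of_nonneg_left ?_ (by positivity))
  -- the four sums
  simp only [thetaTest_compCLM_apply D₁ μ hD₁, thetaTest_compCLM_apply D₂ ν hD₂, compCLM_apply_smul D₁ μ hD₁,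
    compCLM_apply_smul D₂ ν hD₂]
  have hS1 : ∑ x ∈ box 4 L, |thetaTest 4 v ((μ * s) • siteToE x) - thetaTest 4 v ((ν * s) • siteToE x)| ≤
      Lip * (σ / m₁) * |μ - ν| * (2 * (σ / m₁) + 3) ^ 4 / s ^ 4 :=
    sum_abs_theta_dilate_sub_le D₁ D₂ μ ν hD₁ hD₂ hLip0 hLip hσ hvσ hm₁ hμ₁ hν₁ hs hs1 _
  have hS2 : ∑ x ∈ box 4 L, |v ((μ * s) • siteToE x)| ≤ M * (2 * σ + 3) ^ 4 / (m₁ * s) ^ 4 :=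
    (sum_abs_dilate_le hM hvσ hσ (mul_pos hμ0 hs) hμs _).trans (env_div_pow_le hM0 hm₁ hμ₁ hs)
  have hS3 : ∑ x ∈ box 4 L, |thetaTest 4 v ((ν * s) • siteToE x)| ≤ M * (2 * σ + 3) ^ 4 / (m₁ * s) ^ 4 :=
    (sum_abs_theta_dilate_le hM hvσ hσ (mul_pos hν0 hs) hνs _).trans (env_div_pow_le hM0 hm₁ hν₁ hs)
  have hS4 : ∑ x ∈ box 4 L, |v ((μ * s) • siteToE x) - v ((ν * s) • siteToE x)| ≤
      Lip * (σ / m₁) * |μ - ν| * (2 * (σ / m₁) + 3) ^ 4 / s ^ 4 :=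
    sum_abs_dilate_sub_le D₁ D₂ μ ν hD₁ hD₂ hLip0 hLip hσ hvσ hm₁ hμ₁ hν₁ hs hs1 _
  have hA0 : 0 ≤ Lip * (σ / m₁) * |μ - ν| * (2 * (σ / m₁) + 3) ^ 4 / s ^ 4 := by positivity
  have hB0 : 0 ≤ M * (2 * σ + 3) ^ 4 / (m₁ * s) ^ 4 := by positivity
  calc (∑ x ∈ box 4 L, |thetaTest 4 v ((μ * s) • siteToE x) - thetaTest 4 v ((ν * s) • siteToE x)|) *
          (∑ x ∈ box 4 L, |v ((μ * s) • siteToE x)|) +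
        (∑ x ∈ box 4 L, |thetaTest 4 v ((ν * s) • siteToE x)|) *
          (∑ x ∈ box 4 L, |v ((μ * s) • siteToE x) - v ((ν * s) • siteToE x)|)
      ≤ (Lip * (σ / m₁) * |μ - ν| * (2 * (σ / m₁) + 3) ^ 4 / s ^ 4) * (M * (2 * σ + 3) ^ 4 / (m₁ * s) ^ 4) +
          (M * (2 * σ + 3) ^ 4 / (m₁ * s) ^ 4) * (Lip * (σ / m₁) * |μ - ν| * (2 * (σ / m₁) + 3) ^ 4 / s ^ 4) :=
        add_le_add (mul_le_mul hS1 hS2 (Finset.sum_nonneg fun _ _ => abs_nonneg _) hA0)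
          (mul_le_mul hS3 hS4 (Finset.sum_nonneg fun _ _ => abs_nonneg _) hB0)
    _ = 2 * ((Lip * (σ / m₁) * |μ - ν| * (2 * (σ / m₁) + 3) ^ 4 / s ^ 4) * (M * (2 * σ + 3) ^ 4 / (m₁ * s) ^ 4)) := by
        ring

/-- **Modulus of the dilation family for the smeared three-point functional under the collar bound.**  Same setting with three
witnesses `f, g, h` (common sup `M`, Lipschitz `Lip`, supports in `B̄(0, σ)`) whose charged points are pairwise at distance
`≥ δ`, parameters with `|μ − ν|·(σ/m₁) ≤ δ/2`, and collar room `4(R+2)s ≤ δ/(2m₂)`: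
`|Q3(s)(f_μ, g_μ, h_μ) − Q3(s)(f_ν, g_ν, h_ν)| ≤ (C/R⁴)³ · 3 · (Lip (σ/m₁)|μ−ν|(2σ/m₁+3)⁴/s⁴) · (M(2σ+3)⁴/(m₁s)⁴)²`. [folklore] -/
theorem abs_Q3_dilate_sub_le (β : ℝ) (L : ℕ) {C : ℝ} {R : ℕ}
    (H : ∀ (n : ℕ) (x : Fin n → (Fin 4 → ℤ)),
      (∀ i j : Fin n, i ≠ j → ∃ k : Fin 4,
        (2 * (R : ℤ) + 4) ≤ |((((x i k - x j k : ℤ) : ZMod (2 * L + 1))).valMinAbs : ℤ)|) →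
      |torusE G r β L (fun U => ∏ i, (dens G r (x i) U - torusE G r β L (dens G r (x i))))| ≤ (C / (R : ℝ) ^ 4) ^ n)
    {f g h : 𝓢(EuclideanSpace ℝ (Fin 4), ℝ)} {M Lip σ δ m₁ m₂ μ ν s : ℝ}
    (hMf : ∀ y : EuclideanSpace ℝ (Fin 4), |f y| ≤ M) (hMg : ∀ y : EuclideanSpace ℝ (Fin 4), |g y| ≤ M)
    (hMh : ∀ y : EuclideanSpace ℝ (Fin 4), |h y| ≤ M) (hLip0 : 0 ≤ Lip)
    (hLf : ∀ x y : EuclideanSpace ℝ (Fin 4), |f x - f y| ≤ Lip * ‖x - y‖)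
    (hLg : ∀ x y : EuclideanSpace ℝ (Fin 4), |g x - g y| ≤ Lip * ‖x - y‖)
    (hLh : ∀ x y : EuclideanSpace ℝ (Fin 4), |h x - h y| ≤ Lip * ‖x - y‖) (hσ : 0 ≤ σ)
    (hfσ : tsupport (f : EuclideanSpace ℝ (Fin 4) → ℝ) ⊆ Metric.closedBall 0 σ)
    (hgσ : tsupport (g : EuclideanSpace ℝ (Fin 4) → ℝ) ⊆ Metric.closedBall 0 σ)
    (hhσ : tsupport (h : EuclideanSpace ℝ (Fin 4) → ℝ) ⊆ Metric.closedBall 0 σ)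
    (hfg : ∀ p q : EuclideanSpace ℝ (Fin 4), f p ≠ 0 → g q ≠ 0 → δ ≤ ‖p - q‖)
    (hgh : ∀ p q : EuclideanSpace ℝ (Fin 4), g p ≠ 0 → h q ≠ 0 → δ ≤ ‖p - q‖)
    (hfh : ∀ p q : EuclideanSpace ℝ (Fin 4), f p ≠ 0 → h q ≠ 0 → δ ≤ ‖p - q‖) (hδ : 0 ≤ δ) (hC : 0 ≤ C)
    (hm₁ : 0 < m₁) (hμ₁ : m₁ ≤ μ) (hμ₂ : μ ≤ m₂) (hν₁ : m₁ ≤ ν) (hν₂ : ν ≤ m₂)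
    (hclose : |μ - ν| * (σ / m₁) ≤ δ / 2)
    (hs : 0 < s) (hs1 : s ≤ 1) (hμs : μ * s ≤ 1) (hνs : ν * s ≤ 1)
    (hσL : 2 * (σ / m₁) ≤ s * L) (hRδ : 4 * ((R : ℝ) + 2) * s ≤ δ / (2 * m₂))
    (D₁ D₂ : EuclideanSpace ℝ (Fin 4) ≃L[ℝ] EuclideanSpace ℝ (Fin 4)) (hD₁ : ∀ x, D₁ x = μ • x) (hD₂ : ∀ x, D₂ x = ν • x) :
    |Q3 G r β L s (SchwartzMap.compCLMOfContinuousLinearEquiv ℝ D₁ f) (SchwartzMap.compCLMOfContinuousLinearEquiv ℝ D₁ g)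
          (SchwartzMap.compCLMOfContinuousLinearEquiv ℝ D₁ h) -
        Q3 G r β L s (SchwartzMap.compCLMOfContinuousLinearEquiv ℝ D₂ f) (SchwartzMap.compCLMOfContinuousLinearEquiv ℝ D₂ g)
          (SchwartzMap.compCLMOfContinuousLinearEquiv ℝ D₂ h)| ≤
      (C / (R : ℝ) ^ 4) ^ 3 * (3 * ((Lip * (σ / m₁) * |μ - ν| * (2 * (σ / m₁) + 3) ^ 4 / s ^ 4) *
        (M * (2 * σ + 3) ^ 4 / (m₁ * s) ^ 4) ^ 2)) := by
  have hμ0 : 0 < μ := hm₁.trans_le hμ₁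
  have hν0 : 0 < ν := hm₁.trans_le hν₁
  have hM0 : 0 ≤ M := (abs_nonneg _).trans (hMf 0)
  have hclose' : |ν - μ| * (σ / m₁) ≤ δ / 2 := by rwa [abs_sub_comm]
  -- charged points: within radius σ/m₁, pairwise δ/(2m₂)-separated, hence torus-separated
  have hcharged : ∀ {w : 𝓢(EuclideanSpace ℝ (Fin 4), ℝ)}, tsupport (w : EuclideanSpace ℝ (Fin 4) → ℝ) ⊆ Metric.closedBall 0 σ →
      ∀ x : Fin 4 → ℤ, (SchwartzMap.compCLMOfContinuousLinearEquiv ℝ D₁ w (s • siteToE x) ≠ 0 ∨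
        SchwartzMap.compCLMOfContinuousLinearEquiv ℝ D₂ w (s • siteToE x) ≠ 0) →
        (w (μ • (s • siteToE x)) ≠ 0 ∨ w (ν • (s • siteToE x)) ≠ 0) ∧ ‖s • siteToE x‖ ≤ σ / m₁ := by
    intro w hwσ x hx
    simp only [SchwartzMap.compCLMOfContinuousLinearEquiv_apply, Function.comp_apply, hD₁, hD₂] at hx
    refine ⟨hx, ?_⟩
    rcases hx with hx | hx
    · exact norm_le_of_dilate_ne_zero' hwσ hm₁ hμ₁ hx
    · exact norm_le_of_dilate_ne_zero' hwσ hm₁ hν₁ hx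
  have hsep : ∀ {w₁ w₂ : 𝓢(EuclideanSpace ℝ (Fin 4), ℝ)},
      (∀ p q : EuclideanSpace ℝ (Fin 4), w₁ p ≠ 0 → w₂ q ≠ 0 → δ ≤ ‖p - q‖) →
      tsupport (w₁ : EuclideanSpace ℝ (Fin 4) → ℝ) ⊆ Metric.closedBall 0 σ →
      tsupport (w₂ : EuclideanSpace ℝ (Fin 4) → ℝ) ⊆ Metric.closedBall 0 σ →
      ∀ x y : Fin 4 → ℤ,
        (SchwartzMap.compCLMOfContinuousLinearEquiv ℝ D₁ w₁ (s • siteToE x) ≠ 0 ∨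
          SchwartzMap.compCLMOfContinuousLinearEquiv ℝ D₂ w₁ (s • siteToE x) ≠ 0) →
        (SchwartzMap.compCLMOfContinuousLinearEquiv ℝ D₁ w₂ (s • siteToE y) ≠ 0 ∨
          SchwartzMap.compCLMOfContinuousLinearEquiv ℝ D₂ w₂ (s • siteToE y) ≠ 0) →
        ∃ k : Fin 4, (2 * (R : ℤ) + 4) ≤ |((((x k - y k : ℤ) : ZMod (2 * L + 1))).valMinAbs : ℤ)| := by
    intro w₁ w₂ hw hw₁σ hw₂σ x y hx hy
    obtain ⟨hx', hxn⟩ := hcharged hw₁σ x hx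
    obtain ⟨hy', hyn⟩ := hcharged hw₂σ y hy
    refine torusSep_of_dist hs hσL hRδ hxn hyn ?_
    rcases hx' with hx' | hx' <;> rcases hy' with hy' | hy'
    · exact dist_ge_of_charged_dilates hw hw₂σ hm₁ hμ₁ hμ₂ hμ₁ (by rw [sub_self, abs_zero, zero_mul]; positivity) hx' hy'
    · exact dist_ge_of_charged_dilates hw hw₂σ hm₁ hμ₁ hμ₂ hν₁ hclose hx' hy'
    · exact dist_ge_of_charged_dilates hw hw₂σ hm₁ hν₁ hν₂ hμ₁ hclose' hx' hy'
    · exact dist_ge_of_charged_dilates hw hw₂σ hm₁ hν₁ hν₂ hν₁ (by rw [sub_self, abs_zero, zero_mul]; positivity) hx' hy'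
  have hb := abs_Q3_sub_Q3_le G r β L s (SchwartzMap.compCLMOfContinuousLinearEquiv ℝ D₁ f)
    (SchwartzMap.compCLMOfContinuousLinearEquiv ℝ D₂ f) (SchwartzMap.compCLMOfContinuousLinearEquiv ℝ D₁ g)
    (SchwartzMap.compCLMOfContinuousLinearEquiv ℝ D₂ g) (SchwartzMap.compCLMOfContinuousLinearEquiv ℝ D₁ h)
    (SchwartzMap.compCLMOfContinuousLinearEquiv ℝ D₂ h) (B := (C / (R : ℝ) ^ 4) ^ 3)
    (fun x _ y _ z _ hx hy hz => abs_torusK3_le_of_momentBound G r β L H x y z (hsep hfg hfσ hgσ x y hx hy)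
      (hsep hgh hgσ hhσ y z hy hz) (hsep hfh hfσ hhσ x z hx hz))
  refine hb.trans (mul_le_mul_of_nonneg_left ?_ (by positivity))
  -- the sums
  simp only [compCLM_apply_smul D₁ μ hD₁, compCLM_apply_smul D₂ ν hD₂]
  have hD : ∀ {w : 𝓢(EuclideanSpace ℝ (Fin 4), ℝ)}, (∀ x y : EuclideanSpace ℝ (Fin 4), |w x - w y| ≤ Lip * ‖x - y‖) →
      tsupport (w : EuclideanSpace ℝ (Fin 4) → ℝ) ⊆ Metric.closedBall 0 σ →
      ∑ x ∈ box 4 L, |w ((μ * s) • siteToE x) - w ((ν * s) • siteToE x)| ≤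
        Lip * (σ / m₁) * |μ - ν| * (2 * (σ / m₁) + 3) ^ 4 / s ^ 4 :=
    fun hLw hwσ => sum_abs_dilate_sub_le D₁ D₂ μ ν hD₁ hD₂ hLip0 hLw hσ hwσ hm₁ hμ₁ hν₁ hs hs1 _
  have hSμ : ∀ {w : 𝓢(EuclideanSpace ℝ (Fin 4), ℝ)}, (∀ y : EuclideanSpace ℝ (Fin 4), |w y| ≤ M) →
      tsupport (w : EuclideanSpace ℝ (Fin 4) → ℝ) ⊆ Metric.closedBall 0 σ →
      ∑ x ∈ box 4 L, |w ((μ * s) • siteToE x)| ≤ M * (2 * σ + 3) ^ 4 / (m₁ * s) ^ 4 :=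
    fun hMw hwσ => (sum_abs_dilate_le hMw hwσ hσ (mul_pos hμ0 hs) hμs _).trans (env_div_pow_le hM0 hm₁ hμ₁ hs)
  have hSν : ∀ {w : 𝓢(EuclideanSpace ℝ (Fin 4), ℝ)}, (∀ y : EuclideanSpace ℝ (Fin 4), |w y| ≤ M) →
      tsupport (w : EuclideanSpace ℝ (Fin 4) → ℝ) ⊆ Metric.closedBall 0 σ →
      ∑ x ∈ box 4 L, |w ((ν * s) • siteToE x)| ≤ M * (2 * σ + 3) ^ 4 / (m₁ * s) ^ 4 :=
    fun hMw hwσ => (sum_abs_dilate_le hMw hwσ hσ (mul_pos hν0 hs) hνs _).trans (env_div_pow_le hM0 hm₁ hν₁ hs)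
  set Dsum : ℝ := Lip * (σ / m₁) * |μ - ν| * (2 * (σ / m₁) + 3) ^ 4 / s ^ 4 with hDsum
  set Sm : ℝ := M * (2 * σ + 3) ^ 4 / (m₁ * s) ^ 4 with hSm
  have hD0 : 0 ≤ Dsum := by positivity
  have hS0 : 0 ≤ Sm := by positivity
  have hnn : ∀ (w : 𝓢(EuclideanSpace ℝ (Fin 4), ℝ)) (t : ℝ), 0 ≤ ∑ x ∈ box 4 L, |w (t • siteToE x)| :=
    fun w t => Finset.sum_nonneg fun _ _ => abs_nonneg _
  have hnn' : ∀ (w : 𝓢(EuclideanSpace ℝ (Fin 4), ℝ)), 0 ≤ ∑ x ∈ box 4 L, |w ((μ * s) • siteToE x) - w ((ν * s) • siteToE x)| :=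
    fun w => Finset.sum_nonneg fun _ _ => abs_nonneg _
  calc (∑ x ∈ box 4 L, |f ((μ * s) • siteToE x) - f ((ν * s) • siteToE x)|) *
            (∑ y ∈ box 4 L, |g ((μ * s) • siteToE y)|) * (∑ z ∈ box 4 L, |h ((μ * s) • siteToE z)|) +
          (∑ x ∈ box 4 L, |f ((ν * s) • siteToE x)|) *
            (∑ y ∈ box 4 L, |g ((μ * s) • siteToE y) - g ((ν * s) • siteToE y)|) * (∑ z ∈ box 4 L, |h ((μ * s) • siteToE z)|) +
          (∑ x ∈ box 4 L, |f ((ν * s) • siteToE x)|) * (∑ y ∈ box 4 L, |g ((ν * s) • siteToE y)|) *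
            (∑ z ∈ box 4 L, |h ((μ * s) • siteToE z) - h ((ν * s) • siteToE z)|)
      ≤ Dsum * Sm * Sm + Sm * Dsum * Sm + Sm * Sm * Dsum := by
        refine add_le_add (add_le_add ?_ ?_) ?_
        · exact mul_le_mul (mul_le_mul (hD hLf hfσ) (hSμ hMg hgσ) (hnn g _) hD0) (hSμ hMh hhσ) (hnn h _)
            (mul_nonneg hD0 hS0)
        · exact mul_le_mul (mul_le_mul (hSν hMf hfσ) (hD hLg hgσ) (hnn' g) hS0) (hSμ hMh hhσ) (hnn h _)
            (mul_nonneg hS0 hD0)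
        · exact mul_le_mul (mul_le_mul (hSν hMf hfσ) (hSν hMg hgσ) (hnn g _) hS0) (hD hLh hhσ) (hnn' h)
            (mul_nonneg hS0 hS0)
    _ = 3 * (Dsum * Sm ^ 2) := by ring

end Modulus

end Summit.QuantumFields.YangMills.Cruxes.NT.Subsequential

end
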